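import Summits.QuantumFields.BalabanUV.Beta.FP.TowerHN2RowMixedWard

/-!
# `BalabanUV.Beta.FP.TowerHN2RowMixedDoor` — road «FP», binder row D1, ROUTE T (β1): **THE MIXED SECTOR OF THE SECOND-ORDER H-ROW WITH THE DOOR-VALUED RESIDUAL ROW** —
# `TowerHN2RowMixedWard` ∕ `TowerHN2RowMixed` VERBATIM except that the residual row (J-R₂) «the symmetrised `Ŝ`-contraction of the Ward remainder VANISHES» (located false by
# value at n = 0: Engine C K2L-C ∕ K2L-DTAD, road verdict [D1P3-G47-K2LC]) is replaced by its DOOR-VALUED form **(J-R₂Δ) `hR₂ : Σ_β (Ŝ_{a′} β • Σ_s λ_a s • Rs s β + Ŝ_a β • Σ_s λ_{a′} s • Rs s β) = D`**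
# for a DISPLAYED torus table `D` (SPEC-64 §3 (ii-A)(b): (T2) read as the DEFINITION of the door; an2 J-NOTE-19 §3: `𝒲Δ|ff := κΔ • (that contraction)`, `κΔ ∋ −cM₂·r`), and the door is
# CARRIED: (J-Λ₂′) acquires `− (cM₂·r) • D`, (J-Λ₂) acquires `+ (−(cM₂·r) • D) (p,α) (q,β)` — the shape `TowerHN2RowDoor` consumes

WHY (journal l.68647 road g53 ONLINE∕PLAN; `g52/V10-PLAN.md` §2 (b) «the remainder moved right»).  v10 feeds NamedC the N-family `WN♮ + 𝒲Δ`; its `hHN₂` then needs the door's wound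
table on the right of v9's H-row, and v9's derivation ((J-ΛS), (K2b) inhabited by definition via `TowerK2bStoreyBridge.wardRow_of_defect`, the locks `hcM₂ hL`) survives VERBATIM once
`= 0` is `= D`: §0 is `commutator_pair_of_wardRow` with `hR : … = D` (conclusion `… − t • D`), §1∕§2 are `hJΛ2'_of_wardRow` ∕ `hJΛ2_of_mixedLock_of_mixedGauge` with the door carried
(`eq_sub_iff_add_eq`, `sub_left_inj`; the mixed lock `mixed_lock_combine` BY NAME).  The door-free files are the case `D = 0`.

WHAT ([folklore] `Matrix`∕`Finset` bookkeeping BY NAME; the two files' letters VERBATIM + the door letter `D`; no `def`, no `def … : Prop`, nothing cited, 0 sorry):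
§0 **`commutator_pair_of_wardRow_door`**; §1 **`hJΛ2'_of_wardRow_door`** — `c•([E_a, Λ₁(r•e_{a′})] + [E_{a′}, Λ₁(r•e_a)]) = (cM₂·r) • Σ_bΣ_β ((Dλ_a)_b·Ŝ_{a′} β + (Dλ_{a′})_b·Ŝ_a β) • ℳ̂₂ b β − (cM₂·r) • D`
from (J-ΛS) `hΛS`, (K2b) `hK2b`, the lock `hL`, (J-R₂Δ) `hR₂`; §2 **`hJΛ2_of_mixedLock_of_mixedGauge_door (p q α β)`** — `(Λ₂ (r•e_a) (r•e_{a′}) + c•(…)) (p,α) (q,β)` = PART 23 §4's two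
mixed words `+ (−(cM₂·r) • D) (p,α) (q,β)` from the mixed display `hΛ₂`, the lock `hcM₂`, (J-Λ₂′)−door `hJΛ₂'`.
WHAT THIS IS NOT: not the door's value, inhabitation or vanishing (K2L-DTAD: inhabited, non-zero at n = 0 — zero weight); not (J-R₂Δ)'s inhabitation (v10 DISPLAYS it as (T2): the
door's source-wound torus table; the row's ONE file owes it from J-NOTE-19 §3's definition); nothing of Bałaban's asserted, valued or discharged; 0 estimates; 0∕4 row-D1 binders (hW, hR,
D1Tel, D1Rep); ROOT M‴ p325680 ∕ P5c ∕ D6 untouched; NOT (C1), NOT (T-ID), NOT D1, NEVER «G-an2-4 closed», NOT BetaPertH, NOT continuum, NOT Clay.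

HONEST DEPENDENCY (page 1, mandatory): continuum YM on T⁴ ⇐ BetaPertH ∧ nine spine estimates (0/9 proved); BetaPertH ⇐ (D1) ∧ (D4) ∧ CAP+tail;
G-an2-4 gates asym, D1 and NE2/3/4.  HONEST FRAMING (cell contract, verbatim): «discharging `BetaPertH` makes Bałaban's UV stability UNCONDITIONAL —
a real constructive-QFT result; it is NOT the continuum limit and NOT the Clay problem.»  ABSOLUTE RULE (cell charter, verbatim): «No internally-minted
statement may enter as a cited fact. Every hypothesis is either kernel-proved in this package or a verbatim quotation of a PUBLISHED theorem with page
reference. The manuscript(s) under audit are NOT citable for their own disputed steps — they are the thing under adjudication; programme-internal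
(2001/route/tribunal) claims are never citable.»  Road «FP» OWNER, b2b-balaban-beta-d1-p3 gen 53, 2026-08-28.  No existing file touched.
-/

noncomputable section

open scoped BigOperators

namespace Summit.QuantumFields.BalabanUV.Beta.FP.TowerHN2RowMixedDoor

open Finset Matrix

open Finset Matrix
open Literature.MathematicalPhysics.QuantumFieldTheory
open Literature.MathematicalPhysics.QuantumFieldTheory.Balaban1983to89
open Literature.MathematicalPhysics.QuantumFieldTheory.Balaban1983to89.Beta
open B4TorusKernel.MultiPeriod (translate)
open B5Prop11Plancherel (fine)
open B6Lemma24Torus (pbox)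
open AffineAveraging (Site box toSite)
open AveragingContoursRooted (ctr ctrOff)
open OneStepResolventKernel (Fib)
open StepJetData (wilsonA)
open WilsonBiStencil (wilsonW₂)
open BalabanStepW2 (M2Of)
open Summit.QuantumFields.BalabanUV.Beta.TameKernelCalculus (trK)
open Summit.QuantumFields.BalabanUV.Beta.BorderedHessian (sgnK)
open Summit.QuantumFields.BalabanUV.Beta.SymShiftedSpread (bhKStepSh)
open Summit.QuantumFields.BalabanUV.Beta.DshAn1 (Dsh)
open Summit.QuantumFields.BalabanUV.Beta.AxialDressingRooted (one_le_of_neZero)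
open Summit.QuantumFields.BalabanUV.Beta.CompositeOneShotJets (tabsComp)
open Summit.QuantumFields.BalabanUV.Beta.CompositeOneShotJetData (Roots Pins AN WN)
open Summit.QuantumFields.BalabanUV.Beta.FP.KernelPeriodisationFib (Idx perF)
open Summit.QuantumFields.BalabanUV.Beta.FP.KernelPeriodisationFibLoc (dper)
open Summit.QuantumFields.BalabanUV.Beta.FP.TorusGaugeCovariance (tgrad)
open Summit.QuantumFields.BalabanUV.Beta.FP.TorusGaugeCovariancePairing (wrapPt)
open Summit.QuantumFields.BalabanUV.Beta.FP.TorusCompositeObjects (towerTorus)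
open Summit.QuantumFields.BalabanUV.Beta.FP.TowerHN1Row (map_smul_of_linear)
open Summit.QuantumFields.BalabanUV.Beta.FP.TowerQN1RowJet (direction_add_exact_eq_smul_col)
open Summit.QuantumFields.BalabanUV.Beta.FP.TowerHN2RowMixed (mixed_lock_combine)

/-! ## §0 Finite-dimensional algebra: the commutator pair from Ward rows with a door-valued remainder contraction -/

section Algebra

/-- [folklore] **the commutator pair from a Ward row, a source display, one lock and a DOOR**: as `TowerHN2RowMixedWard.commutator_pair_of_wardRow`, but the remainders'
contraction is a displayed `D` (`Σ_β (S′ β • Rm β + S β • Rm′ β) = D`); then `c•([E,Λ′] + [E′,Λ]) = t • Σ_bΣ_β (d_b S′_β + d′_b S_β) • M b β − t • D`. -/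
theorem commutator_pair_of_wardRow_door {ι ι' : Type*} [Fintype ι] [Fintype ι'] (E E' : Matrix ι ι ℝ) (C : ι' → Matrix ι ι ℝ) (S S' : ι' → ℝ)
    (d d' : ι → ℝ) (Mx : ι → ι' → Matrix ι ι ℝ) (Rm Rm' : ι' → Matrix ι ι ℝ) (κ₂ : ℝ)
    (hK : ∀ β, ∑ b, d b • Mx b β = κ₂ • (E * C β - C β * E) + Rm β) (hK' : ∀ β, ∑ b, d' b • Mx b β = κ₂ • (E' * C β - C β * E') + Rm' β)
    (Λ Λ' : Matrix ι ι ℝ) (cS : ℝ) (hΛ : Λ = cS • ∑ β, S β • C β) (hΛ' : Λ' = cS • ∑ β, S' β • C β)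
    (c t : ℝ) (hlock : c * cS = t * κ₂) (D : Matrix ι ι ℝ) (hR : ∑ β, (S' β • Rm β + S β • Rm' β) = D) :
    c • (E * Λ' - Λ' * E + (E' * Λ - Λ * E')) = t • ∑ b, ∑ β, (d b * S' β + d' b * S β) • Mx b β - t • D := by
  have step : c • (E * Λ' - Λ' * E + (E' * Λ - Λ * E')) + t • ∑ β, (S' β • Rm β + S β • Rm' β)
      = t • ∑ β, (S' β • ∑ b, d b • Mx b β + S β • ∑ b, d' b • Mx b β) := by
    simp only [hK, hK', hΛ, hΛ', Matrix.mul_smul, Matrix.smul_mul, Finset.mul_sum, Finset.sum_mul, Finset.smul_sum, smul_add, smul_sub,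
      ← Finset.sum_add_distrib, ← Finset.sum_sub_distrib]
    refine Finset.sum_congr rfl fun β _ => ?_
    simp only [smul_smul, ← mul_assoc]
    rw [hlock]
    module
  rw [hR] at step
  rw [eq_sub_iff_add_eq, step, Finset.sum_comm]
  refine congrArg _ (Finset.sum_congr rfl fun β _ => ?_)
  rw [Finset.smul_sum, Finset.smul_sum, ← Finset.sum_add_distrib]
  exact Finset.sum_congr rfl fun b _ => by module

end Algebra


/-! ## §1 The residual gauge row (J-Λ₂′) from (J-ΛS), (K2b), the lock and the DOOR-VALUED (J-R₂Δ) -/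

section Row

variable {Lc : ℕ} [NeZero Lc] (M : Fin (3 + 1) → ℕ) [∀ μ, NeZero (M μ)] (n : ℕ) (c : ℝ) (Pn : Pins)
  {κ : Type*} [DecidableEq κ] (yN : κ → Site (3 + 1)) (μN : κ → Fin (3 + 1))
  -- PART 2 ∕ 3a's letters that the lump (J-Λ₂′) mentions: the tree-gauge read-out `lv`, the NAME `Λ₁` of the order-1 Λ-words (#7), the mixed table's NAME `M₂` (PART 3a's
  -- letter `hM₂` pins it for the consumer), the mixed weight `cM₂`, the pin factor `r`, the two sources
  (lv : (κ → ℝ) → (↥(pbox (towerTorus Lc (fine Lc M) (n + 1))) → ℝ))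
  (Λ₁ : (κ → ℝ) → Matrix (↥(pbox (towerTorus Lc (fine Lc M) (n + 1))) × Fin (3 + 1)) (↥(pbox (towerTorus Lc (fine Lc M) (n + 1))) × Fin (3 + 1)) ℝ)
  (M₂ : ↥(pbox (towerTorus Lc (fine Lc M) (n + 1))) × Fin (3 + 1) → ↥(pbox M) × Fin (3 + 1) → Matrix (↥(pbox (towerTorus Lc (fine Lc M) (n + 1))) × Fin (3 + 1)) (↥(pbox (towerTorus Lc (fine Lc M) (n + 1))) × Fin (3 + 1)) ℝ) (cM₂ : ℝ)
  (r : ℝ) (a a' : κ)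
  -- (J-ΛS): THE ORDER-1 Λ-WORDS ALONG THE PINNED SOURCES are the torus constraint-Hessian family `Ĉ_β := (perF T (dper T ((tabsComp (n+2) …).H β.2 ↑β.1)))|ff`
  -- (the periodised COMPOSITE constraint Hessian, written out — an2 g70 W-1 (ii)) superposed with the chart's multiplier column `Ŝ_a` — J-NOTE-12 §3's (J-Λ♮)∘(K1′)
  (cΛS κ₂ : ℝ)
  (hΛS : ∀ a₀ : κ, Λ₁ (r • (Pi.single a₀ (1 : ℝ) : κ → ℝ)) = cΛS • ∑ β : ↥(pbox M) × Fin (3 + 1),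
      perF (towerTorus Lc (fine Lc M) (n + 1)) (AN (Roots.ctr Lc) (n + 1)) (wrapPt (towerTorus Lc (fine Lc M) (n + 1)) (((Lc ^ (n + 1 + 1) : ℕ) : ℤ) • (β.1 : Site (3 + 1))), Sum.inr β.2) (wrapPt (towerTorus Lc (fine Lc M) (n + 1)) (((Lc ^ (n + 1 + 1) : ℕ) : ℤ) • yN a₀), Sum.inr (μN a₀))
        • (perF (towerTorus Lc (fine Lc M) (n + 1)) (dper (towerTorus Lc (fine Lc M) (n + 1)) ((tabsComp (n + 1 + 1) (one_le_of_neZero Lc) (Roots.ctr Lc).hr (Pn.cM (n + 1 + 1))).H β.2 (β.1 : Site (3 + 1))))).submatrix (fun b : ↥(pbox (towerTorus Lc (fine Lc M) (n + 1))) × Fin (3 + 1) => ((b.1, Sum.inl b.2) : Idx (towerTorus Lc (fine Lc M) (n + 1)) (Fib 3))) (fun b : ↥(pbox (towerTorus Lc (fine Lc M) (n + 1))) × Fin (3 + 1) => ((b.1, Sum.inl b.2) : Idx (towerTorus Lc (fine Lc M) (n + 1)) (Fib 3))))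
  -- (K2b): THE MIXED TABLE's FINE PURE-GAUGE (WARD) ROW — the generator's commutator with `Ĉ_β` plus a displayed site-remainder family `Rs` (`0` in the pure case;
  -- intended otherwise: an1's remainder of `Beta/CombMixedT2SiteLetter.divV_mixedT2_site_of_lock`, periodised) — for EVERY gauge function `lam` on the torus sites
  (Rs : ↥(pbox (towerTorus Lc (fine Lc M) (n + 1))) → ↥(pbox M) × Fin (3 + 1) → Matrix (↥(pbox (towerTorus Lc (fine Lc M) (n + 1))) × Fin (3 + 1)) (↥(pbox (towerTorus Lc (fine Lc M) (n + 1))) × Fin (3 + 1)) ℝ)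
  (hK2b : ∀ (lam : ↥(pbox (towerTorus Lc (fine Lc M) (n + 1))) → ℝ) (β : ↥(pbox M) × Fin (3 + 1)),
      ∑ b : ↥(pbox (towerTorus Lc (fine Lc M) (n + 1))) × Fin (3 + 1), (∑ s : ↥(pbox (towerTorus Lc (fine Lc M) (n + 1))), tgrad (towerTorus Lc (fine Lc M) (n + 1)) (b.1, Sum.inl b.2) s * lam s) • M₂ b β
        = κ₂ • (Matrix.diagonal (fun b : ↥(pbox (towerTorus Lc (fine Lc M) (n + 1))) × Fin (3 + 1) => lam b.1) * (perF (towerTorus Lc (fine Lc M) (n + 1)) (dper (towerTorus Lc (fine Lc M) (n + 1)) ((tabsComp (n + 1 + 1) (one_le_of_neZero Lc) (Roots.ctr Lc).hr (Pn.cM (n + 1 + 1))).H β.2 (β.1 : Site (3 + 1))))).submatrix (fun b : ↥(pbox (towerTorus Lc (fine Lc M) (n + 1))) × Fin (3 + 1) => ((b.1, Sum.inl b.2) : Idx (towerTorus Lc (fine Lc M) (n + 1)) (Fib 3))) (fun b : ↥(pbox (towerTorus Lc (fine Lc M) (n + 1))) × Fin (3 + 1) => ((b.1, Sum.inl b.2)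 : Idx (towerTorus Lc (fine Lc M) (n + 1)) (Fib 3)))
          - (perF (towerTorus Lc (fine Lc M) (n + 1)) (dper (towerTorus Lc (fine Lc M) (n + 1)) ((tabsComp (n + 1 + 1) (one_le_of_neZero Lc) (Roots.ctr Lc).hr (Pn.cM (n + 1 + 1))).H β.2 (β.1 : Site (3 + 1))))).submatrix (fun b : ↥(pbox (towerTorus Lc (fine Lc M) (n + 1))) × Fin (3 + 1) => ((b.1, Sum.inl b.2) : Idx (towerTorus Lc (fine Lc M) (n + 1)) (Fib 3))) (fun b : ↥(pbox (towerTorus Lc (fine Lc M) (n + 1))) × Fin (3 + 1) => ((b.1, Sum.inl b.2) : Idx (towerTorus Lc (fine Lc M) (n + 1)) (Fib 3))) * Matrix.diagonal (fun b : ↥(pbox (towerTorus Lc (fine Lc M) (n + 1))) × Fin (3 + 1) => lam b.1))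
          + ∑ s : ↥(pbox (towerTorus Lc (fine Lc M) (n + 1))), lam s • Rs s β)
  -- THE Λ-SIDE SCALAR LOCK (J-NOTE-12 §3 (L)) and THE RESIDUAL ROW (J-R₂) (the remainder's `Ŝ`-contraction, symmetrised in the two sources; trivial when `Rs = 0`)
  (hL : c * cΛS = cM₂ * r * κ₂)
  -- THE DOOR (v10): the remainder's symmetrised `Ŝ`-contraction IS a displayed torus table `D` (the door-free (J-R₂) is `D = 0`)
  (D : Matrix (↥(pbox (towerTorus Lc (fine Lc M) (n + 1))) × Fin (3 + 1)) (↥(pbox (towerTorus Lc (fine Lc M) (n + 1))) × Fin (3 + 1)) ℝ)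
  (hR₂ : ∑ β : ↥(pbox M) × Fin (3 + 1), (perF (towerTorus Lc (fine Lc M) (n + 1)) (AN (Roots.ctr Lc) (n + 1)) (wrapPt (towerTorus Lc (fine Lc M) (n + 1)) (((Lc ^ (n + 1 + 1) : ℕ) : ℤ) • (β.1 : Site (3 + 1))), Sum.inr β.2) (wrapPt (towerTorus Lc (fine Lc M) (n + 1)) (((Lc ^ (n + 1 + 1) : ℕ) : ℤ) • yN a'), Sum.inr (μN a')) • ∑ s : ↥(pbox (towerTorus Lc (fine Lc M) (n + 1))), lv (r • (Pi.single a (1 : ℝ) : κ → ℝ)) s • Rs s β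
        + perF (towerTorus Lc (fine Lc M) (n + 1)) (AN (Roots.ctr Lc) (n + 1)) (wrapPt (towerTorus Lc (fine Lc M) (n + 1)) (((Lc ^ (n + 1 + 1) : ℕ) : ℤ) • (β.1 : Site (3 + 1))), Sum.inr β.2) (wrapPt (towerTorus Lc (fine Lc M) (n + 1)) (((Lc ^ (n + 1 + 1) : ℕ) : ℤ) • yN a), Sum.inr (μN a)) • ∑ s : ↥(pbox (towerTorus Lc (fine Lc M) (n + 1))), lv (r • (Pi.single a' (1 : ℝ) : κ → ℝ)) s • Rs s β) = D)

include hΛS hK2b hL hR₂ in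
/-- [folklore] **`hJΛ2'_of_wardRow_door` — (J-Λ₂′) WITH THE DOOR MOVED RIGHT**: `c•([E_a, Λ₁(r•e_{a′})] + [E_{a′}, Λ₁(r•e_a)]) = (cM₂·r) • Σ_bΣ_β ((Dλ_a)_b·Ŝ_{a′} β + (Dλ_{a′})_b·Ŝ_a β) • ℳ̂₂ b β − (cM₂·r) • D`
(§0 at the generators, the Ward rows `hK2b λ_a ∕ hK2b λ_{a′}`, the displays `hΛS a ∕ hΛS a′`, the lock `hL`, the door-valued residual row `hR₂`). -/
theorem hJΛ2'_of_wardRow_door :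
    c • (Matrix.diagonal (fun b : ↥(pbox (towerTorus Lc (fine Lc M) (n + 1))) × Fin (3 + 1) => lv (r • (Pi.single a (1 : ℝ) : κ → ℝ)) b.1) * Λ₁ (r • (Pi.single a' (1 : ℝ) : κ → ℝ))
              - Λ₁ (r • (Pi.single a' (1 : ℝ) : κ → ℝ)) * Matrix.diagonal (fun b : ↥(pbox (towerTorus Lc (fine Lc M) (n + 1))) × Fin (3 + 1) => lv (r • (Pi.single a (1 : ℝ) : κ → ℝ)) b.1)
              + (Matrix.diagonal (fun b : ↥(pbox (towerTorus Lc (fine Lc M) (n + 1))) × Fin (3 + 1) => lv (r • (Pi.single a' (1 : ℝ) : κ → ℝ)) b.1) * Λ₁ (r • (Pi.single a (1 : ℝ) : κ → ℝ))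
                - Λ₁ (r • (Pi.single a (1 : ℝ) : κ → ℝ)) * Matrix.diagonal (fun b : ↥(pbox (towerTorus Lc (fine Lc M) (n + 1))) × Fin (3 + 1) => lv (r • (Pi.single a' (1 : ℝ) : κ → ℝ)) b.1)))
      = (cM₂ * r) • ∑ b : ↥(pbox (towerTorus Lc (fine Lc M) (n + 1))) × Fin (3 + 1), ∑ β : ↥(pbox M) × Fin (3 + 1),
          ((∑ s : ↥(pbox (towerTorus Lc (fine Lc M) (n + 1))), tgrad (towerTorus Lc (fine Lc M) (n + 1)) (b.1, Sum.inl b.2) s * lv (r • (Pi.single a (1 : ℝ) : κ → ℝ)) s)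
              * perF (towerTorus Lc (fine Lc M) (n + 1)) (AN (Roots.ctr Lc) (n + 1)) (wrapPt (towerTorus Lc (fine Lc M) (n + 1)) (((Lc ^ (n + 1 + 1) : ℕ) : ℤ) • (β.1 : Site (3 + 1))), Sum.inr β.2)
              (wrapPt (towerTorus Lc (fine Lc M) (n + 1)) (((Lc ^ (n + 1 + 1) : ℕ) : ℤ) • yN a'), Sum.inr (μN a'))
            + (∑ s : ↥(pbox (towerTorus Lc (fine Lc M) (n + 1))), tgrad (towerTorus Lc (fine Lc M) (n + 1)) (b.1, Sum.inl b.2) s * lv (r • (Pi.single a' (1 : ℝ) : κ → ℝ)) s)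
              * perF (towerTorus Lc (fine Lc M) (n + 1)) (AN (Roots.ctr Lc) (n + 1)) (wrapPt (towerTorus Lc (fine Lc M) (n + 1)) (((Lc ^ (n + 1 + 1) : ℕ) : ℤ) • (β.1 : Site (3 + 1))), Sum.inr β.2)
              (wrapPt (towerTorus Lc (fine Lc M) (n + 1)) (((Lc ^ (n + 1 + 1) : ℕ) : ℤ) • yN a), Sum.inr (μN a))) • M₂ b β
        - (cM₂ * r) • D :=
  commutator_pair_of_wardRow_door
    (Matrix.diagonal (fun b : ↥(pbox (towerTorus Lc (fine Lc M) (n + 1))) × Fin (3 + 1) => lv (r • (Pi.single a (1 : ℝ) : κ → ℝ)) b.1)) (Matrix.diagonal (fun b : ↥(pbox (towerTorus Lc (fine Lc M) (n + 1))) × Fin (3 + 1) => lv (r • (Pi.single a' (1 : ℝ) : κ → ℝ)) b.1))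
    (fun β : ↥(pbox M) × Fin (3 + 1) => (perF (towerTorus Lc (fine Lc M) (n + 1)) (dper (towerTorus Lc (fine Lc M) (n + 1)) ((tabsComp (n + 1 + 1) (one_le_of_neZero Lc) (Roots.ctr Lc).hr (Pn.cM (n + 1 + 1))).H β.2 (β.1 : Site (3 + 1))))).submatrix (fun b : ↥(pbox (towerTorus Lc (fine Lc M) (n + 1))) × Fin (3 + 1) => ((b.1, Sum.inl b.2) : Idx (towerTorus Lc (fine Lc M) (n + 1)) (Fib 3))) (fun b : ↥(pbox (towerTorus Lc (fine Lc M) (n + 1))) × Fin (3 + 1) => ((b.1, Sum.inl b.2) : Idx (towerTorus Lc (fine Lc M) (n + 1)) (Fib 3))))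
    (fun β : ↥(pbox M) × Fin (3 + 1) => perF (towerTorus Lc (fine Lc M) (n + 1)) (AN (Roots.ctr Lc) (n + 1)) (wrapPt (towerTorus Lc (fine Lc M) (n + 1)) (((Lc ^ (n + 1 + 1) : ℕ) : ℤ) • (β.1 : Site (3 + 1))), Sum.inr β.2) (wrapPt (towerTorus Lc (fine Lc M) (n + 1)) (((Lc ^ (n + 1 + 1) : ℕ) : ℤ) • yN a), Sum.inr (μN a)))
    (fun β : ↥(pbox M) × Fin (3 + 1) => perF (towerTorus Lc (fine Lc M) (n + 1)) (AN (Roots.ctr Lc) (n + 1)) (wrapPt (towerTorus Lc (fine Lc M) (n + 1)) (((Lc ^ (n + 1 + 1) : ℕ) : ℤ) • (β.1 : Site (3 + 1))), Sum.inr β.2) (wrapPt (towerTorus Lc (fine Lc M) (n + 1)) (((Lc ^ (n + 1 + 1) : ℕ) : ℤ) • yN a'), Sum.inr (μN a')))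
    (fun b : ↥(pbox (towerTorus Lc (fine Lc M) (n + 1))) × Fin (3 + 1) => ∑ s : ↥(pbox (towerTorus Lc (fine Lc M) (n + 1))), tgrad (towerTorus Lc (fine Lc M) (n + 1)) (b.1, Sum.inl b.2) s * lv (r • (Pi.single a (1 : ℝ) : κ → ℝ)) s)
    (fun b : ↥(pbox (towerTorus Lc (fine Lc M) (n + 1))) × Fin (3 + 1) => ∑ s : ↥(pbox (towerTorus Lc (fine Lc M) (n + 1))), tgrad (towerTorus Lc (fine Lc M) (n + 1)) (b.1, Sum.inl b.2) s * lv (r • (Pi.single a' (1 : ℝ) : κ → ℝ)) s) M₂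
    (fun β : ↥(pbox M) × Fin (3 + 1) => ∑ s : ↥(pbox (towerTorus Lc (fine Lc M) (n + 1))), lv (r • (Pi.single a (1 : ℝ) : κ → ℝ)) s • Rs s β) (fun β : ↥(pbox M) × Fin (3 + 1) => ∑ s : ↥(pbox (towerTorus Lc (fine Lc M) (n + 1))), lv (r • (Pi.single a' (1 : ℝ) : κ → ℝ)) s • Rs s β) κ₂
    (fun β => hK2b _ β) (fun β => hK2b _ β) (Λ₁ (r • (Pi.single a (1 : ℝ) : κ → ℝ))) (Λ₁ (r • (Pi.single a' (1 : ℝ) : κ → ℝ))) cΛS (hΛS a) (hΛS a') c (cM₂ * r) hL D hR₂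

end Row


/-! ## §2 The displayed row (J-Λ₂) entrywise, with the door carried -/

section Mixed

variable {Lc : ℕ} [NeZero Lc] (M : Fin (3 + 1) → ℕ) [∀ μ, NeZero (M μ)] (n : ℕ) (c : ℝ) (Pn : Pins)
  {κ : Type*} [DecidableEq κ] (yN : κ → Site (3 + 1)) (μN : κ → Fin (3 + 1))
  (hv : (κ → ℝ) → (↥(pbox (towerTorus Lc (fine Lc M) (n + 1))) × Fin (3 + 1) → ℝ))
  (hhvl : ∀ (r : ℝ) (x y : κ → ℝ), hv (r • x + y) = r • hv x + hv y)
  (lv : (κ → ℝ) → (↥(pbox (towerTorus Lc (fine Lc M) (n + 1))) → ℝ))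
  (hlv : ∀ (r : ℝ) (x y : κ → ℝ), lv (r • x + y) = r • lv x + lv y)
  (hJW : ∀ (a : κ) (b : ↥(pbox (towerTorus Lc (fine Lc M) (n + 1))) × Fin (3 + 1)), hv (Pi.single a 1) b
      = perF (towerTorus Lc (fine Lc M) (n + 1)) (AN (Roots.ctr Lc) (n + 1)) (b.1, Sum.inl b.2)
          (wrapPt (towerTorus Lc (fine Lc M) (n + 1)) (((Lc ^ (n + 1 + 1) : ℕ) : ℤ) • yN a), Sum.inr (μN a))
        - ∑ s : ↥(pbox (towerTorus Lc (fine Lc M) (n + 1))), tgrad (towerTorus Lc (fine Lc M) (n + 1)) (b.1, Sum.inl b.2) s * lv (Pi.single a 1) s)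
  -- THE MULTIPLIER-COLUMN FAMILY `hm` (linear) with its junction letter `hJM`: the source `e_a`'s coarse multiplier weights are the `Ŝ`-column of PART 23
  (hm : (κ → ℝ) → (↥(pbox M) × Fin (3 + 1) → ℝ))
  (hml : ∀ (r : ℝ) (x y : κ → ℝ), hm (r • x + y) = r • hm x + hm y)
  (hJM : ∀ (a : κ) (β : ↥(pbox M) × Fin (3 + 1)), hm (Pi.single a 1) β
      = perF (towerTorus Lc (fine Lc M) (n + 1)) (AN (Roots.ctr Lc) (n + 1)) (wrapPt (towerTorus Lc (fine Lc M) (n + 1)) (((Lc ^ (n + 1 + 1) : ℕ) : ℤ) • (β.1 : Site (3 + 1))), Sum.inr β.2)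
              (wrapPt (towerTorus Lc (fine Lc M) (n + 1)) (((Lc ^ (n + 1 + 1) : ℕ) : ℤ) • yN a), Sum.inr (μN a)))
  -- THE MIXED TABLE LETTER: the row's wound even mixed table `ℳ̂₂ᵉ` (PART 23), fine field bond `b`, coarse multiplier bond `β`, `ff` block
  (M₂ : ↥(pbox (towerTorus Lc (fine Lc M) (n + 1))) × Fin (3 + 1) → ↥(pbox M) × Fin (3 + 1) → Matrix (↥(pbox (towerTorus Lc (fine Lc M) (n + 1))) × Fin (3 + 1)) (↥(pbox (towerTorus Lc (fine Lc M) (n + 1))) × Fin (3 + 1)) ℝ)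
  (hM₂ : ∀ (b : ↥(pbox (towerTorus Lc (fine Lc M) (n + 1))) × Fin (3 + 1)) (β : ↥(pbox M) × Fin (3 + 1)), M₂ b β = (perF (towerTorus Lc (fine Lc M) (n + 1)) (dper (towerTorus Lc (fine Lc M) (n + 1)) (fun X Z i₁ i₂ => ∑' m : Site (3 + 1),
              ((1 / 2 : ℝ) • (M2Of 3 (Lc ^ (n + 1 + 1)) (tabsComp (n + 1 + 1) (one_le_of_neZero Lc) (Roots.ctr Lc).hr (Pn.cM (n + 1 + 1))).mixFF 0 b.2 (b.1 : Site (3 + 1)) β.2 (translate M (β.1 : Site (3 + 1)) m)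
                + sgnK (trK (M2Of 3 (Lc ^ (n + 1 + 1)) (tabsComp (n + 1 + 1) (one_le_of_neZero Lc) (Roots.ctr Lc).hr (Pn.cM (n + 1 + 1))).mixFF 0 b.2 (b.1 : Site (3 + 1)) β.2 (translate M (β.1 : Site (3 + 1)) m))))) X Z i₁ i₂))).submatrix
            (fun b : ↥(pbox (towerTorus Lc (fine Lc M) (n + 1))) × Fin (3 + 1) => ((b.1, Sum.inl b.2) : Idx (towerTorus Lc (fine Lc M) (n + 1)) (Fib 3)))
            (fun b : ↥(pbox (towerTorus Lc (fine Lc M) (n + 1))) × Fin (3 + 1) => ((b.1, Sum.inl b.2) : Idx (towerTorus Lc (fine Lc M) (n + 1)) (Fib 3))))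
  -- THE DISPLAY of #7's remainder `Λ₂` as the MIXED SECTOR with weight `cM₂`
  (Λ₁ : (κ → ℝ) → Matrix (↥(pbox (towerTorus Lc (fine Lc M) (n + 1))) × Fin (3 + 1)) (↥(pbox (towerTorus Lc (fine Lc M) (n + 1))) × Fin (3 + 1)) ℝ)
  (Λ₂ : (κ → ℝ) → (κ → ℝ) → Matrix (↥(pbox (towerTorus Lc (fine Lc M) (n + 1))) × Fin (3 + 1)) (↥(pbox (towerTorus Lc (fine Lc M) (n + 1))) × Fin (3 + 1)) ℝ) (cM₂ : ℝ)
  (hΛ₂ : ∀ v v', Λ₂ v v' = cM₂ • ∑ b : ↥(pbox (towerTorus Lc (fine Lc M) (n + 1))) × Fin (3 + 1), ∑ β : ↥(pbox M) × Fin (3 + 1), (hv v b * hm v' β + hv v' b * hm v β) • M₂ b β)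
  (r : ℝ) (a a' : κ)
  -- THE MIXED LOCK ROW and THE RESIDUAL GAUGE ROW (J-Λ₂′)
  (hcM₂ : cM₂ * r * r = 1)
  -- THE DOOR (v10): (J-Λ₂′) with the door-valued residual row moved right (`TowerHN2RowMixedDoor.hJΛ2'_of_wardRow_door`'s conclusion)
  (D : Matrix (↥(pbox (towerTorus Lc (fine Lc M) (n + 1))) × Fin (3 + 1)) (↥(pbox (towerTorus Lc (fine Lc M) (n + 1))) × Fin (3 + 1)) ℝ)
  (hJΛ₂' : c • (Matrix.diagonal (fun b : ↥(pbox (towerTorus Lc (fine Lc M) (n + 1))) × Fin (3 + 1) => lv (r • (Pi.single a (1 : ℝ) : κ → ℝ)) b.1) * Λ₁ (r • (Pi.single a' (1 : ℝ) : κ → ℝ))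
              - Λ₁ (r • (Pi.single a' (1 : ℝ) : κ → ℝ)) * Matrix.diagonal (fun b : ↥(pbox (towerTorus Lc (fine Lc M) (n + 1))) × Fin (3 + 1) => lv (r • (Pi.single a (1 : ℝ) : κ → ℝ)) b.1)
              + (Matrix.diagonal (fun b : ↥(pbox (towerTorus Lc (fine Lc M) (n + 1))) × Fin (3 + 1) => lv (r • (Pi.single a' (1 : ℝ) : κ → ℝ)) b.1) * Λ₁ (r • (Pi.single a (1 : ℝ) : κ → ℝ))
                - Λ₁ (r • (Pi.single a (1 : ℝ) : κ → ℝ)) * Matrix.diagonal (fun b : ↥(pbox (towerTorus Lc (fine Lc M) (n + 1))) × Fin (3 + 1) => lv (r • (Pi.single a' (1 : ℝ) : κ → ℝ)) b.1)))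
      = (cM₂ * r) • ∑ b : ↥(pbox (towerTorus Lc (fine Lc M) (n + 1))) × Fin (3 + 1), ∑ β : ↥(pbox M) × Fin (3 + 1),
          ((∑ s : ↥(pbox (towerTorus Lc (fine Lc M) (n + 1))), tgrad (towerTorus Lc (fine Lc M) (n + 1)) (b.1, Sum.inl b.2) s * lv (r • (Pi.single a (1 : ℝ) : κ → ℝ)) s)
              * perF (towerTorus Lc (fine Lc M) (n + 1)) (AN (Roots.ctr Lc) (n + 1)) (wrapPt (towerTorus Lc (fine Lc M) (n + 1)) (((Lc ^ (n + 1 + 1) : ℕ) : ℤ) • (β.1 : Site (3 + 1))), Sum.inr β.2)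
              (wrapPt (towerTorus Lc (fine Lc M) (n + 1)) (((Lc ^ (n + 1 + 1) : ℕ) : ℤ) • yN a'), Sum.inr (μN a'))
            + (∑ s : ↥(pbox (towerTorus Lc (fine Lc M) (n + 1))), tgrad (towerTorus Lc (fine Lc M) (n + 1)) (b.1, Sum.inl b.2) s * lv (r • (Pi.single a' (1 : ℝ) : κ → ℝ)) s)
              * perF (towerTorus Lc (fine Lc M) (n + 1)) (AN (Roots.ctr Lc) (n + 1)) (wrapPt (towerTorus Lc (fine Lc M) (n + 1)) (((Lc ^ (n + 1 + 1) : ℕ) : ℤ) • (β.1 : Site (3 + 1))), Sum.inr β.2)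
              (wrapPt (towerTorus Lc (fine Lc M) (n + 1)) (((Lc ^ (n + 1 + 1) : ℕ) : ℤ) • yN a), Sum.inr (μN a))) • M₂ b β
        - (cM₂ * r) • D)

include hhvl hlv hJW hml hJM hM₂ hΛ₂ hcM₂ hJΛ₂' in
/-- [folklore] **`hJΛ2_of_mixedLock_of_mixedGauge_door` — (J-Λ₂) FROM THE MIXED DISPLAY, THE LOCK `hcM₂` AND (J-Λ₂′)−door**: at `(a, a′)`, for every entry,
`(Λ₂ (r•e_a) (r•e_{a′}) + c•([E_a, Λ₁(r•e_{a′})] + [E_{a′}, Λ₁(r•e_a)])) (p,α) (q,β)` = PART 23 §4's two mixed words `+ (−(cM₂·r) • D) (p,α) (q,β)` (`mixed_lock_combine` BY NAME). -/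
theorem hJΛ2_of_mixedLock_of_mixedGauge_door (p q : ↥(pbox (towerTorus Lc (fine Lc M) (n + 1)))) (α β : Fin (3 + 1)) :
    (Λ₂ (r • (Pi.single a (1 : ℝ) : κ → ℝ)) (r • (Pi.single a' (1 : ℝ) : κ → ℝ))
            + c • (Matrix.diagonal (fun b : ↥(pbox (towerTorus Lc (fine Lc M) (n + 1))) × Fin (3 + 1) => lv (r • (Pi.single a (1 : ℝ) : κ → ℝ)) b.1) * Λ₁ (r • (Pi.single a' (1 : ℝ) : κ → ℝ))
              - Λ₁ (r • (Pi.single a' (1 : ℝ) : κ → ℝ)) * Matrix.diagonal (fun b : ↥(pbox (towerTorus Lc (fine Lc M) (n + 1))) × Fin (3 + 1) => lv (r • (Pi.single a (1 : ℝ) : κ → ℝ)) b.1)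
              + (Matrix.diagonal (fun b : ↥(pbox (towerTorus Lc (fine Lc M) (n + 1))) × Fin (3 + 1) => lv (r • (Pi.single a' (1 : ℝ) : κ → ℝ)) b.1) * Λ₁ (r • (Pi.single a (1 : ℝ) : κ → ℝ))
                - Λ₁ (r • (Pi.single a (1 : ℝ) : κ → ℝ)) * Matrix.diagonal (fun b : ↥(pbox (towerTorus Lc (fine Lc M) (n + 1))) × Fin (3 + 1) => lv (r • (Pi.single a' (1 : ℝ) : κ → ℝ)) b.1)))) (p, α) (q, β)
      = (∑ u : ↥(pbox (towerTorus Lc (fine Lc M) (n + 1))), ∑ κ : Fin (3 + 1), ∑ w : ↥(pbox M), ∑ ρ : Fin (3 + 1),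
          perF (towerTorus Lc (fine Lc M) (n + 1)) (AN (Roots.ctr Lc) (n + 1)) (u, Sum.inl κ) (wrapPt (towerTorus Lc (fine Lc M) (n + 1)) (((Lc ^ (n + 1 + 1) : ℕ) : ℤ) • yN a), Sum.inr (μN a))
            * (perF (towerTorus Lc (fine Lc M) (n + 1)) (AN (Roots.ctr Lc) (n + 1)) (wrapPt (towerTorus Lc (fine Lc M) (n + 1)) (((Lc ^ (n + 1 + 1) : ℕ) : ℤ) • (w : Site (3 + 1))), Sum.inr ρ) (wrapPt (towerTorus Lc (fine Lc M) (n + 1)) (((Lc ^ (n + 1 + 1) : ℕ) : ℤ) • yN a'), Sum.inr (μN a'))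
                * perF (towerTorus Lc (fine Lc M) (n + 1)) (dper (towerTorus Lc (fine Lc M) (n + 1)) (fun X Z i₁ i₂ => ∑' m : Site (3 + 1),
            ((1 / 2 : ℝ) • (M2Of 3 (Lc ^ (n + 1 + 1)) (tabsComp (n + 1 + 1) (one_le_of_neZero Lc) (Roots.ctr Lc).hr (Pn.cM (n + 1 + 1))).mixFF 0 κ (u : Site (3 + 1)) ρ (translate M (w : Site (3 + 1)) m) + sgnK (trK (M2Of 3 (Lc ^ (n + 1 + 1)) (tabsComp (n + 1 + 1) (one_le_of_neZero Lc) (Roots.ctr Lc).hr (Pn.cM (n + 1 + 1))).mixFF 0 κ (u : Site (3 + 1)) ρ (translate M (w : Site (3 + 1)) m))))) X Z i₁ i₂)) (p, Sum.inl α) (q, Sum.inl β)))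
          + (∑ u : ↥(pbox (towerTorus Lc (fine Lc M) (n + 1))), ∑ κ : Fin (3 + 1), ∑ w : ↥(pbox M), ∑ ρ : Fin (3 + 1),
          perF (towerTorus Lc (fine Lc M) (n + 1)) (AN (Roots.ctr Lc) (n + 1)) (u, Sum.inl κ) (wrapPt (towerTorus Lc (fine Lc M) (n + 1)) (((Lc ^ (n + 1 + 1) : ℕ) : ℤ) • yN a'), Sum.inr (μN a'))
            * (perF (towerTorus Lc (fine Lc M) (n + 1)) (AN (Roots.ctr Lc) (n + 1)) (wrapPt (towerTorus Lc (fine Lc M) (n + 1)) (((Lc ^ (n + 1 + 1) : ℕ) : ℤ) • (w : Site (3 + 1))), Sum.inr ρ) (wrapPt (towerTorus Lc (fine Lc M) (n + 1)) (((Lc ^ (n + 1 + 1) : ℕ) : ℤ) • yN a), Sum.inr (μN a))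
                * perF (towerTorus Lc (fine Lc M) (n + 1)) (dper (towerTorus Lc (fine Lc M) (n + 1)) (fun X Z i₁ i₂ => ∑' m : Site (3 + 1),
            ((1 / 2 : ℝ) • (M2Of 3 (Lc ^ (n + 1 + 1)) (tabsComp (n + 1 + 1) (one_le_of_neZero Lc) (Roots.ctr Lc).hr (Pn.cM (n + 1 + 1))).mixFF 0 κ (u : Site (3 + 1)) ρ (translate M (w : Site (3 + 1)) m) + sgnK (trK (M2Of 3 (Lc ^ (n + 1 + 1)) (tabsComp (n + 1 + 1) (one_le_of_neZero Lc) (Roots.ctr Lc).hr (Pn.cM (n + 1 + 1))).mixFF 0 κ (u : Site (3 + 1)) ρ (translate M (w : Site (3 + 1)) m))))) X Z i₁ i₂)) (p, Sum.inl α) (q, Sum.inl β)))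
        + (-(cM₂ * r) • D) (p, α) (q, β) := by
  -- (J-W″) solved for the nested direction, and the multiplier columns along `r•e_a`
  have hva : ∀ a₀ : κ, hv (r • (Pi.single a₀ (1 : ℝ) : κ → ℝ)) = (r • fun b : ↥(pbox (towerTorus Lc (fine Lc M) (n + 1))) × Fin (3 + 1) =>
        perF (towerTorus Lc (fine Lc M) (n + 1)) (AN (Roots.ctr Lc) (n + 1)) (b.1, Sum.inl b.2)
          (wrapPt (towerTorus Lc (fine Lc M) (n + 1)) (((Lc ^ (n + 1 + 1) : ℕ) : ℤ) • yN a₀), Sum.inr (μN a₀)))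
      - (fun b : ↥(pbox (towerTorus Lc (fine Lc M) (n + 1))) × Fin (3 + 1) =>
            ∑ s : ↥(pbox (towerTorus Lc (fine Lc M) (n + 1))), tgrad (towerTorus Lc (fine Lc M) (n + 1)) (b.1, Sum.inl b.2) s * lv (r • (Pi.single a₀ (1 : ℝ) : κ → ℝ)) s) := fun a₀ =>
    eq_sub_of_add_eq (direction_add_exact_eq_smul_col M n yN μN hv hhvl lv hlv hJW r a₀)
  have hma : ∀ (a₀ : κ) (β₀ : ↥(pbox M) × Fin (3 + 1)), hm (r • (Pi.single a₀ (1 : ℝ) : κ → ℝ)) β₀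
      = r * perF (towerTorus Lc (fine Lc M) (n + 1)) (AN (Roots.ctr Lc) (n + 1)) (wrapPt (towerTorus Lc (fine Lc M) (n + 1)) (((Lc ^ (n + 1 + 1) : ℕ) : ℤ) • (β₀.1 : Site (3 + 1))), Sum.inr β₀.2)
              (wrapPt (towerTorus Lc (fine Lc M) (n + 1)) (((Lc ^ (n + 1 + 1) : ℕ) : ℤ) • yN a₀), Sum.inr (μN a₀)) := fun a₀ β₀ => by
    rw [map_smul_of_linear hm hml, Pi.smul_apply, smul_eq_mul, hJM]
  -- the entry, combined by the lock into the `colN̂–Ŝ` words over the road's table letter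
  have key : (Λ₂ (r • (Pi.single a (1 : ℝ) : κ → ℝ)) (r • (Pi.single a' (1 : ℝ) : κ → ℝ))
            + c • (Matrix.diagonal (fun b : ↥(pbox (towerTorus Lc (fine Lc M) (n + 1))) × Fin (3 + 1) => lv (r • (Pi.single a (1 : ℝ) : κ → ℝ)) b.1) * Λ₁ (r • (Pi.single a' (1 : ℝ) : κ → ℝ))
              - Λ₁ (r • (Pi.single a' (1 : ℝ) : κ → ℝ)) * Matrix.diagonal (fun b : ↥(pbox (towerTorus Lc (fine Lc M) (n + 1))) × Fin (3 + 1) => lv (r • (Pi.single a (1 : ℝ) : κ → ℝ)) b.1)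
              + (Matrix.diagonal (fun b : ↥(pbox (towerTorus Lc (fine Lc M) (n + 1))) × Fin (3 + 1) => lv (r • (Pi.single a' (1 : ℝ) : κ → ℝ)) b.1) * Λ₁ (r • (Pi.single a (1 : ℝ) : κ → ℝ))
                - Λ₁ (r • (Pi.single a (1 : ℝ) : κ → ℝ)) * Matrix.diagonal (fun b : ↥(pbox (towerTorus Lc (fine Lc M) (n + 1))) × Fin (3 + 1) => lv (r • (Pi.single a' (1 : ℝ) : κ → ℝ)) b.1)))) (p, α) (q, β)
      = ∑ b : ↥(pbox (towerTorus Lc (fine Lc M) (n + 1))) × Fin (3 + 1), ∑ β₀ : ↥(pbox M) × Fin (3 + 1),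
          (perF (towerTorus Lc (fine Lc M) (n + 1)) (AN (Roots.ctr Lc) (n + 1)) (b.1, Sum.inl b.2)
              (wrapPt (towerTorus Lc (fine Lc M) (n + 1)) (((Lc ^ (n + 1 + 1) : ℕ) : ℤ) • yN a), Sum.inr (μN a))
              * perF (towerTorus Lc (fine Lc M) (n + 1)) (AN (Roots.ctr Lc) (n + 1)) (wrapPt (towerTorus Lc (fine Lc M) (n + 1)) (((Lc ^ (n + 1 + 1) : ℕ) : ℤ) • (β₀.1 : Site (3 + 1))), Sum.inr β₀.2)
              (wrapPt (towerTorus Lc (fine Lc M) (n + 1)) (((Lc ^ (n + 1 + 1) : ℕ) : ℤ) • yN a'), Sum.inr (μN a'))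
            + perF (towerTorus Lc (fine Lc M) (n + 1)) (AN (Roots.ctr Lc) (n + 1)) (b.1, Sum.inl b.2)
              (wrapPt (towerTorus Lc (fine Lc M) (n + 1)) (((Lc ^ (n + 1 + 1) : ℕ) : ℤ) • yN a'), Sum.inr (μN a'))
              * perF (towerTorus Lc (fine Lc M) (n + 1)) (AN (Roots.ctr Lc) (n + 1)) (wrapPt (towerTorus Lc (fine Lc M) (n + 1)) (((Lc ^ (n + 1 + 1) : ℕ) : ℤ) • (β₀.1 : Site (3 + 1))), Sum.inr β₀.2)
              (wrapPt (towerTorus Lc (fine Lc M) (n + 1)) (((Lc ^ (n + 1 + 1) : ℕ) : ℤ) • yN a), Sum.inr (μN a))) * M₂ b β₀ (p, α) (q, β) - (cM₂ * r) * D (p, α) (q, β) := by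
    rw [Matrix.add_apply, hJΛ₂', hΛ₂, hva a, hva a']
    simp only [hma, Pi.sub_apply, Pi.smul_apply, smul_eq_mul, Matrix.smul_apply, Matrix.sum_apply, Matrix.sub_apply]
    rw [← add_sub_assoc, sub_left_inj]
    exact mixed_lock_combine cM₂ r hcM₂ _ _ _ _ _ _ _
  rw [key, Matrix.smul_apply, smul_eq_mul, neg_mul, ← sub_eq_add_neg, sub_left_inj]
  simp only [add_mul, Finset.sum_add_distrib, hM₂, Matrix.submatrix_apply, Fintype.sum_prod_type, mul_assoc]

end Mixed

end Summit.QuantumFields.BalabanUV.Beta.FP.TowerHN2RowMixedDoor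

end
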